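import Mathlib.Analysis.SpecialFunctions.Complex.LogBounds
import Mathlib.Topology.Algebra.InfiniteSum.Real
import Mathlib.Topology.Instances.ENNReal.Lemmas
import Literature.RingTheory.SymmetricFunctions.CauchyIdentityAnalytic
import HarnessLib

/-!
# The self Shintani sum `∑_m |w(m)|² t^{|m|}` in `[0, ∞]`: finiteness forces `|x_i|² t < 1`

Topic `RingTheory/SymmetricFunctions`; namespace `Literature.RingTheory.SymmetricFunctions.SymmPoly`.
Sequel to `CauchyIdentityAnalytic` (everything proved; Mathlib + `SchurPolynomials` +
`CauchyIdentityAnalytic` only).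

For `x ∈ ℂⁿ` and a solution `w : ℕⁿ → ℂ` of the dual Pieri recursions for `x` vanishing off the
antitone weights (so `w = w(0) · s_•(x)`, `eq_schur_smul_of_pieri`; in the application `w(m)` is
the normalised spherical Whittaker function of an unramified representation of `GL_n(F)` with
Satake parameters `x` on the torus element `ϖ^m`, Shintani 1976), `hasSum_shintaniPair` of
`CauchyIdentityAnalytic` evaluates `∑_N (∑_{|m| = N} w(m) w'(m)) t^N` *provided* `|x_i y_j t| < 1`.
In the Rankin–Selberg method for `L(s, π × π̄)` at a real point `s = σ` the pair is `(w, w̄)`, the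
terms `∑_{|m| = N} |w(m)|² t^N` are non-negative, and the sum arises — by unfolding a finite global
integral — as a quantity in `[0, ∞]` about whose finiteness, but not about whose parameters `x`,
something is known. This file supplies the missing link:

* `shintaniSelfSum w t = ∑_N (∑_{|m| = N} |w(m)|²) t^N ∈ [0, ∞]` (**definition**, an `ENNReal`-valued
  `tsum`, `t` real; monotone in `t ≥ 0`, `shintaniSelfSum_mono`);
* `hasSum_shintaniSelf` (**proved**): for `|x_i| |x_j| t < 1` (`t ≥ 0`),
  `∑_N (∑_{|m|=N} |w(m)|²) t^N = |w(0)|² · |∏_{i,j} (1 - x_i x̄_j t)⁻¹|`, and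
  `norm_prod_inv_eq_exp_tsum` (**proved**): `|∏_{i,j} (1 - x_i x̄_j t)⁻¹| = exp ∑_{k ≥ 1} |p_k(x)|² t^k / k`
  with `p_k(x) = ∑_i x_i^k` (the logarithm of Cauchy's product for `y = x̄`:
  `∑_{i,j} (x_i x̄_j)^k = |p_k(x)|²`); hence `shintaniSelfSum_eq_ofReal_exp`;
* `norm_mul_norm_mul_lt_one_of_shintaniSelfSum_ne_top` (**proved**, the point of the file): if
  `w(0) ≠ 0` and `shintaniSelfSum w t < ∞` for some `t ≥ 0`, then `|x_i| |x_j| t < 1` for all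
  `i, j`. Proof: with `ρ = max_i |x_i|`, if `ρ² t ≥ 1` then for `t' ↑ ρ⁻²` the evaluations
  `|w(0)|² ∏_{i,j} |1 - x_i x̄_j t'|⁻¹ ≥ |w(0)|² 2^{-n²} (1 - ρ² t')⁻¹` are unbounded, while by
  monotonicity they are all `≤ shintaniSelfSum w t`;
* the Schur specialisation: `schurTrunc x` (the Schur function `s_•(x)` truncated to antitone
  weights) solves the recursions with value `1` at `0` (`schurTrunc_pieri`), `schurSelfSum x t`, and
  `shintaniSelfSum_eq_mul_schurSelfSum`: `shintaniSelfSum w t = |w(0)|² · schurSelfSum x t`.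

With `x` the Hecke–Satake parameters of a cusp form on `GL_n` at an unramified place `v` and
`t = q_v^{-σ}`, the conclusion `|x_i|² < q_v^{σ}` for all `σ > 1` is the bound `|x_i| ≤ q_v^{1/2}`
of Jacquet–Shalika, Amer. J. Math. 103 (1981), (5.1.3), and `∑_k |p_k(x)|² q_v^{-kσ}/k` is the
local term of their series (5.3.3); the consumer is
`Literature.NumberTheory.Automorphic.JacquetShalikaSchurSelfSum`.

## References

* I. G. Macdonald, *Symmetric Functions and Hall Polynomials*, 2nd ed. (1995), Ch. I (4.3)
  [Macdonald1995].
* T. Shintani, Proc. Japan Acad. 52 (1976), 180–182.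
* H. Jacquet, J. A. Shalika, Amer. J. Math. 103 (1981), 499–558, §2 and proof of Thm. (5.3)
  [JacquetShalikaAJM1981].
-/

noncomputable section

namespace Literature.RingTheory.SymmetricFunctions.SymmPoly

open Finset Filter
open scoped ComplexConjugate ENNReal Topology

variable {n : ℕ}

/-! ### The logarithm of Cauchy's product at `y = x̄` -/

/-- `∑_{i,j} (x_i x̄_j)^k = |p_k(x)|²`, `p_k(x) = ∑_i x_i^k`. [folklore] -/
theorem sum_sum_mul_conj_pow (x : Fin n → ℂ) (k : ℕ) :
    ∑ i, ∑ j, (x i * conj (x j)) ^ k = ((‖∑ i, x i ^ k‖ : ℝ) : ℂ) ^ 2 := by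
  rw [← Complex.mul_conj', map_sum, Finset.sum_mul_sum]
  refine Finset.sum_congr rfl fun i _ => Finset.sum_congr rfl fun j _ => ?_
  rw [mul_pow, map_pow]

/-- For `|x_i| |x_j| t < 1` (`t ≥ 0` real): the series `∑_{k ≥ 1} |p_k(x)|² t^k / k` converges and
`∏_{i,j} (1 - x_i x̄_j t)⁻¹ = exp (∑_{k ≥ 1} |p_k(x)|² t^k / k)` — the logarithm
`-log (1 - z) = ∑_k z^k / k` of each factor, summed over `(i, j)` (Jacquet–Shalika (1981), p. 556,
(1)–(2), for `π' = π̄`). Indexed by `k : ℕ` for the exponent `k + 1`. [folklore] -/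
theorem hasSum_normSq_psum_and_prod_inv_eq_exp (x : Fin n → ℂ) {t : ℝ} (ht0 : 0 ≤ t)
    (ht : ∀ i j, ‖x i‖ * ‖x j‖ * t < 1) :
    ∃ G : ℝ, HasSum (fun k : ℕ => ‖∑ i, x i ^ (k + 1)‖ ^ 2 * t ^ (k + 1) / (k + 1)) G ∧
      ∏ i, ∏ j, (1 - x i * conj (x j) * t)⁻¹ = Complex.exp G := by
  -- each factor
  have hz : ∀ i j, ‖x i * conj (x j) * (t : ℂ)‖ < 1 := fun i j => by
    rw [norm_mul, norm_mul, Complex.norm_conj, Complex.norm_real, Real.norm_of_nonneg ht0]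
    exact ht i j
  have h1 : ∀ i j, HasSum (fun k : ℕ => (x i * conj (x j) * t) ^ (k + 1) / (k + 1))
      (-Complex.log (1 - x i * conj (x j) * t)) := fun i j => by
    have := (hasSum_nat_add_iff' 1).mpr (Complex.hasSum_taylorSeries_neg_log (hz i j))
    simpa using this
  -- summed over `(i, j)`
  have h2 : HasSum (fun k : ℕ => ∑ i, ∑ j, (x i * conj (x j) * t) ^ (k + 1) / (k + 1))
      (∑ i, ∑ j, -Complex.log (1 - x i * conj (x j) * t)) :=
    hasSum_sum fun i _ => hasSum_sum fun j _ => h1 i j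
  have hterm : ∀ k : ℕ, ∑ i, ∑ j, (x i * conj (x j) * t) ^ (k + 1) / (k + 1) =
      (((‖∑ i, x i ^ (k + 1)‖ ^ 2 * t ^ (k + 1) / (k + 1) : ℝ)) : ℂ) := by
    intro k
    have : ∀ i j, (x i * conj (x j) * (t : ℂ)) ^ (k + 1) / (k + 1) =
        (x i * conj (x j)) ^ (k + 1) * ((t : ℂ) ^ (k + 1) / (k + 1)) := fun i j => by ring
    simp_rw [this, ← Finset.sum_mul, sum_sum_mul_conj_pow]
    push_cast
    ring
  simp_rw [hterm] at h2
  set G : ℝ := ∑' k : ℕ, ‖∑ i, x i ^ (k + 1)‖ ^ 2 * t ^ (k + 1) / (k + 1) with hG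
  have hGsum : HasSum (fun k : ℕ => ‖∑ i, x i ^ (k + 1)‖ ^ 2 * t ^ (k + 1) / (k + 1)) G := by
    have hs : Summable fun k : ℕ => ‖∑ i, x i ^ (k + 1)‖ ^ 2 * t ^ (k + 1) / (k + 1) :=
      Complex.summable_ofReal.mp h2.summable
    exact hs.hasSum
  have hGC : HasSum (fun k : ℕ => (((‖∑ i, x i ^ (k + 1)‖ ^ 2 * t ^ (k + 1) / (k + 1) : ℝ)) : ℂ))
      (G : ℂ) := Complex.hasSum_ofReal.mpr hGsum
  refine ⟨G, hGsum, ?_⟩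
  rw [← h2.unique hGC, Complex.exp_sum]
  refine Finset.prod_congr rfl fun i _ => ?_
  rw [Complex.exp_sum]
  refine Finset.prod_congr rfl fun j _ => ?_
  rw [Complex.exp_neg, Complex.exp_log]
  intro h0
  have : ‖x i * conj (x j) * (t : ℂ)‖ = 1 := by
    rw [sub_eq_zero] at h0
    rw [← h0, norm_one]
  exact (hz i j).ne this

/-- Under `|x_i| |x_j| t < 1`: `|∏_{i,j} (1 - x_i x̄_j t)⁻¹| = exp (∑_{k ≥ 1} |p_k(x)|² t^k / k)`;
in particular the product is a positive real number. [folklore] -/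
theorem norm_prod_inv_eq_exp_tsum (x : Fin n → ℂ) {t : ℝ} (ht0 : 0 ≤ t)
    (ht : ∀ i j, ‖x i‖ * ‖x j‖ * t < 1) :
    ‖∏ i, ∏ j, (1 - x i * conj (x j) * t)⁻¹‖ =
      Real.exp (∑' k : ℕ, ‖∑ i, x i ^ (k + 1)‖ ^ 2 * t ^ (k + 1) / (k + 1)) := by
  obtain ⟨G, hG, hprod⟩ := hasSum_normSq_psum_and_prod_inv_eq_exp x ht0 ht
  rw [hprod, hG.tsum_eq, Complex.norm_exp, Complex.ofReal_re]

/-! ### Conjugating a solution of the dual Pieri recursions -/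

/-- If `w` solves the dual Pieri recursions for `x`, then `w̄` solves them for `x̄`
(`e_r(x̄) = \overline{e_r(x)}`). [folklore] -/
theorem pieri_conj {x : Fin n → ℂ} {w : (Fin n → ℕ) → ℂ}
    (hrec : ∀ la, Antitone la → ∀ r, 1 ≤ r → r ≤ n →
      esymm x r * w la = ∑ S ∈ powersetCard r univ, w (addOn S la))
    (la : Fin n → ℕ) (hla : Antitone la) (r : ℕ) (hr1 : 1 ≤ r) (hrn : r ≤ n) :
    esymm (conj ∘ x) r * (conj ∘ w) la = ∑ S ∈ powersetCard r univ, (conj ∘ w) (addOn S la) := by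
  have h := congrArg conj (hrec la hla r hr1 hrn)
  rw [map_mul, map_sum, map_esymm] at h
  simpa using h

/-! ### The self Shintani sum in `[0, ∞]` -/

/-- The **self Shintani sum** `∑_N (∑_{m ∈ ℕⁿ, |m| = N} |w(m)|²) t^N ∈ [0, ∞]` of a function
`w : ℕⁿ → ℂ` at a real `t` (intended for `t ≥ 0`): an unconditional sum of non-negative terms in
`ℝ≥0∞`, finite or not. For `w` the normalised spherical Whittaker function on the torus of an
unramified `π_v` and `t = q_v^{-σ}` this is, up to the factor `|W(1)|²` and the unfolding of the
`p`-adic integral, the local Rankin–Selberg integral `Ψ(σ; W, W̄, 𝟙_{𝒪ⁿ})` of `π_v × π̄_v` at the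
real point `σ` (Jacquet–Shalika (1981), §2). [folklore] -/
def shintaniSelfSum (w : (Fin n → ℕ) → ℂ) (t : ℝ) : ℝ≥0∞ :=
  ∑' N : ℕ, ENNReal.ofReal ((∑ m ∈ piAntidiag univ N, ‖w m‖ ^ 2) * t ^ N)

/-- The self Shintani sum is monotone in `t ≥ 0`. [folklore] -/
theorem shintaniSelfSum_mono (w : (Fin n → ℕ) → ℂ) {t t' : ℝ} (ht' : 0 ≤ t') (h : t' ≤ t) :
    shintaniSelfSum w t' ≤ shintaniSelfSum w t := by
  refine ENNReal.tsum_le_tsum fun N => ENNReal.ofReal_le_ofReal ?_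
  exact mul_le_mul_of_nonneg_left (pow_le_pow_left₀ ht' h N)
    (Finset.sum_nonneg fun m _ => sq_nonneg _)

/-- **The self Shintani sum at a point of absolute convergence.** If `w` solves the dual Pieri
recursions for `x` (vanishing off the antitone weights) and `|x_i| |x_j| t < 1` for all `i, j`
(`t ≥ 0`), then `∑_N (∑_{|m| = N} |w(m)|²) t^N = |w(0)|² |∏_{i,j} (1 - x_i x̄_j t)⁻¹|`, the real
series converging: `hasSum_shintaniPair` for the pair `(w, w̄)` and the parameters `(x, x̄)`
(Cauchy's identity, Macdonald 1995, Ch. I (4.3)). [cite: Macdonald1995, Ch. I (4.3)] -/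
theorem hasSum_shintaniSelf (x : Fin n → ℂ) (w : (Fin n → ℕ) → ℂ)
    (h0 : ∀ ν, ¬ Antitone ν → w ν = 0)
    (hrec : ∀ la, Antitone la → ∀ r, 1 ≤ r → r ≤ n →
      esymm x r * w la = ∑ S ∈ powersetCard r univ, w (addOn S la))
    {t : ℝ} (ht0 : 0 ≤ t) (ht : ∀ i j, ‖x i‖ * ‖x j‖ * t < 1) :
    HasSum (fun N : ℕ => (∑ m ∈ piAntidiag univ N, ‖w m‖ ^ 2) * t ^ N)
      (‖w 0‖ ^ 2 * ‖∏ i, ∏ j, (1 - x i * conj (x j) * t)⁻¹‖) := by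
  have hz : ∀ i j, ‖x i * (conj ∘ x) j * (t : ℂ)‖ < 1 := fun i j => by
    rw [Function.comp_apply, norm_mul, norm_mul, Complex.norm_conj, Complex.norm_real,
      Real.norm_of_nonneg ht0]
    exact ht i j
  have h := hasSum_shintaniPair x (conj ∘ x) w (conj ∘ w) h0 hrec
    (fun ν hν => by simp [h0 ν hν]) (pieri_conj hrec) hz
  -- identify terms and value as real numbers
  have hterm : ∀ N : ℕ, (∑ m ∈ piAntidiag univ N, w m * (conj ∘ w) m) * (t : ℂ) ^ N =
      (((∑ m ∈ piAntidiag univ N, ‖w m‖ ^ 2) * t ^ N : ℝ) : ℂ) := by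
    intro N
    push_cast
    congr 1
    exact Finset.sum_congr rfl fun m _ => Complex.mul_conj' (w m)
  obtain ⟨G, -, hprod⟩ := hasSum_normSq_psum_and_prod_inv_eq_exp x ht0 ht
  have hval : w 0 * (conj ∘ w) 0 * ∏ i, ∏ j, (1 - x i * (conj ∘ x) j * (t : ℂ))⁻¹ =
      ((‖w 0‖ ^ 2 * ‖∏ i, ∏ j, (1 - x i * conj (x j) * (t : ℂ))⁻¹‖ : ℝ) : ℂ) := by
    simp only [Function.comp_apply]
    rw [Complex.mul_conj', hprod, Complex.norm_exp, Complex.ofReal_re, ← Complex.ofReal_exp]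
    push_cast
    ring
  simp_rw [hterm] at h
  rw [hval] at h
  exact Complex.hasSum_ofReal.mp h

/-- Under the same hypotheses, the `[0, ∞]`-valued self Shintani sum is the finite number
`|w(0)|² exp (∑_{k ≥ 1} |p_k(x)|² t^k / k)`. [folklore] -/
theorem shintaniSelfSum_eq_ofReal_exp (x : Fin n → ℂ) (w : (Fin n → ℕ) → ℂ)
    (h0 : ∀ ν, ¬ Antitone ν → w ν = 0)
    (hrec : ∀ la, Antitone la → ∀ r, 1 ≤ r → r ≤ n →
      esymm x r * w la = ∑ S ∈ powersetCard r univ, w (addOn S la))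
    {t : ℝ} (ht0 : 0 ≤ t) (ht : ∀ i j, ‖x i‖ * ‖x j‖ * t < 1) :
    shintaniSelfSum w t = ENNReal.ofReal
      (‖w 0‖ ^ 2 * Real.exp (∑' k : ℕ, ‖∑ i, x i ^ (k + 1)‖ ^ 2 * t ^ (k + 1) / (k + 1))) := by
  have h := hasSum_shintaniSelf x w h0 hrec ht0 ht
  rw [← norm_prod_inv_eq_exp_tsum x ht0 ht, ← h.tsum_eq, shintaniSelfSum]
  exact (ENNReal.ofReal_tsum_of_nonneg
    (fun N => mul_nonneg (Finset.sum_nonneg fun m _ => sq_nonneg _) (pow_nonneg ht0 N))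
    h.summable).symm

/-! ### Finiteness of the self sum bounds the parameters -/

/-- A lower bound for Cauchy's product at `y = x̄`: if `ρ = |x_{i₁}| ≥ |x_i|` for all `i` and
`0 ≤ t`, `ρ² t < 1`, then `|∏_{i,j} (1 - x_i x̄_j t)⁻¹| ≥ 2^{-n²} (1 - ρ² t)⁻¹` (every factor has
`|1 - x_i x̄_j t| ≤ 2`, and the factor `(i₁, i₁)` is `1 - ρ² t`). [folklore] -/
theorem le_norm_prod_inv (x : Fin n → ℂ) {i₁ : Fin n} (hmax : ∀ i, ‖x i‖ ≤ ‖x i₁‖) {t : ℝ}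
    (ht0 : 0 ≤ t) (ht : ‖x i₁‖ ^ 2 * t < 1) :
    ((1 : ℝ) / 2) ^ (n * n) * (1 - ‖x i₁‖ ^ 2 * t)⁻¹ ≤
      ‖∏ i, ∏ j, (1 - x i * conj (x j) * t)⁻¹‖ := by
  classical
  set ρ : ℝ := ‖x i₁‖ with hρ
  have hρ0 : 0 ≤ ρ := norm_nonneg _
  -- pass to a product over pairs
  have hprod : ‖∏ i, ∏ j, (1 - x i * conj (x j) * (t : ℂ))⁻¹‖ =
      ∏ p ∈ (univ : Finset (Fin n × Fin n)), ‖1 - x p.1 * conj (x p.2) * (t : ℂ)‖⁻¹ := by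
    rw [norm_prod, ← Finset.univ_product_univ, Finset.prod_product]
    refine Finset.prod_congr rfl fun i _ => ?_
    rw [norm_prod]
    exact Finset.prod_congr rfl fun j _ => norm_inv _
  rw [hprod]
  -- the comparison function
  let g : Fin n × Fin n → ℝ := fun p => if p = (i₁, i₁) then (1 - ρ ^ 2 * t)⁻¹ else 1 / 2
  have hct : ∀ i j, ‖x i * conj (x j) * (t : ℂ)‖ ≤ ρ ^ 2 * t := fun i j => by
    rw [norm_mul, norm_mul, Complex.norm_conj, Complex.norm_real, Real.norm_of_nonneg ht0, sq]
    exact mul_le_mul_of_nonneg_right (mul_le_mul (hmax i) (hmax j) (norm_nonneg _) hρ0) ht0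
  have hle : ∀ p ∈ (univ : Finset (Fin n × Fin n)), g p ≤ ‖1 - x p.1 * conj (x p.2) * (t : ℂ)‖⁻¹ := by
    rintro ⟨i, j⟩ -
    by_cases hp : (i, j) = (i₁, i₁)
    · simp only [g, if_pos hp]
      rw [Prod.mk.injEq] at hp
      obtain ⟨hi, hj⟩ := hp
      rw [hi, hj]
      have hreal : 1 - x i₁ * conj (x i₁) * (t : ℂ) = ((1 - ρ ^ 2 * t : ℝ) : ℂ) := by
        rw [Complex.mul_conj']
        push_cast
        rfl
      rw [hreal, Complex.norm_real, Real.norm_of_nonneg (by linarith)]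
    · simp only [g, if_neg hp]
      have h2 : ‖1 - x i * conj (x j) * (t : ℂ)‖ ≤ 2 :=
        calc ‖1 - x i * conj (x j) * (t : ℂ)‖ ≤ ‖(1 : ℂ)‖ + ‖x i * conj (x j) * (t : ℂ)‖ :=
              norm_sub_le _ _
          _ ≤ 1 + 1 := by rw [norm_one]; exact add_le_add le_rfl ((hct i j).trans ht.le)
          _ = 2 := by norm_num
      have hpos : 0 < ‖1 - x i * conj (x j) * (t : ℂ)‖ := by
        refine norm_pos_iff.mpr (sub_ne_zero.mpr fun h1 => ?_)
        have : ‖x i * conj (x j) * (t : ℂ)‖ < 1 := (hct i j).trans_lt ht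
        rw [← h1, norm_one] at this
        exact lt_irrefl _ this
      rw [one_div]
      exact inv_anti₀ hpos h2
  have hg0 : ∀ p ∈ (univ : Finset (Fin n × Fin n)), 0 ≤ g p := by
    intro p _
    simp only [g]
    split_ifs
    · exact inv_nonneg.mpr (by linarith)
    · norm_num
  refine le_trans ?_ (Finset.prod_le_prod hg0 hle)
  -- evaluate `∏ g`
  rw [← Finset.mul_prod_erase univ g (Finset.mem_univ (i₁, i₁))]
  have hgi : g (i₁, i₁) = (1 - ρ ^ 2 * t)⁻¹ := by simp [g]
  have hrest : ∏ p ∈ (univ : Finset (Fin n × Fin n)).erase (i₁, i₁), g p =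
      (1 / 2 : ℝ) ^ ((univ : Finset (Fin n × Fin n)).erase (i₁, i₁)).card := by
    rw [← Finset.prod_const]
    refine Finset.prod_congr rfl fun p hp => ?_
    simp only [g, if_neg (Finset.ne_of_mem_erase hp)]
  have hcard : ((univ : Finset (Fin n × Fin n)).erase (i₁, i₁)).card ≤ n * n := by
    rw [Finset.card_erase_of_mem (Finset.mem_univ _), Finset.card_univ, Fintype.card_prod,
      Fintype.card_fin]
    exact Nat.sub_le _ _
  rw [hgi, hrest, mul_comm ((1 - ρ ^ 2 * t)⁻¹)]
  exact mul_le_mul_of_nonneg_right (pow_le_pow_of_le_one (by norm_num) (by norm_num) hcard)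
    (inv_nonneg.mpr (by linarith))

/-- **Finiteness of the self Shintani sum bounds the parameters.** Let `w` solve the dual Pieri
recursions for `x ∈ ℂⁿ` (vanishing off the antitone weights) with `w(0) ≠ 0`, and let `t ≥ 0`. If
`shintaniSelfSum w t = ∑_N (∑_{|m|=N} |w(m)|²) t^N` is finite, then `|x_i| |x_j| t < 1` for all
`i, j` (equivalently `ρ² t < 1`, `ρ = max_i |x_i|`). Proof: otherwise `ρ² t ≥ 1`; at the points
`0 ≤ t' < ρ⁻²` the sum converges to `|w(0)|² |∏_{i,j} (1 - x_i x̄_j t')⁻¹| ≥ |w(0)|² 2^{-n²}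
(1 - ρ² t')⁻¹` (`hasSum_shintaniSelf`, `le_norm_prod_inv`), which is unbounded as `t' ↑ ρ⁻²`,
whereas all these values are `≤ shintaniSelfSum w t < ∞` by monotonicity in `t`. For the
Hecke–Satake parameters of a cusp form on `GL_n` at an unramified place and `t = q_v^{-σ}`,
`σ > 1`, this is how the finiteness of a global Rankin–Selberg integral at the real point `σ`
yields `|x_i|² < q_v^{σ}`, i.e. (letting `σ ↓ 1`) the bound (5.1.3) of Jacquet–Shalika (1981).
[folklore] -/
theorem norm_mul_norm_mul_lt_one_of_shintaniSelfSum_ne_top (x : Fin n → ℂ) (w : (Fin n → ℕ) → ℂ)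
    (h0 : ∀ ν, ¬ Antitone ν → w ν = 0)
    (hrec : ∀ la, Antitone la → ∀ r, 1 ≤ r → r ≤ n →
      esymm x r * w la = ∑ S ∈ powersetCard r univ, w (addOn S la))
    (hw0 : w 0 ≠ 0) {t : ℝ} (ht0 : 0 ≤ t) (hfin : shintaniSelfSum w t ≠ ⊤) (i j : Fin n) :
    ‖x i‖ * ‖x j‖ * t < 1 := by
  by_contra! hij
  -- `ρ = |x i₁| = max_i |x_i|`, and `ρ² t ≥ 1`
  obtain ⟨i₁, -, hmax⟩ := Finset.exists_max_image univ (fun i => ‖x i‖) ⟨i, Finset.mem_univ i⟩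
  set ρ : ℝ := ‖x i₁‖ with hρ
  have hmax' : ∀ k, ‖x k‖ ≤ ρ := fun k => hmax k (Finset.mem_univ k)
  have hρ0 : 0 ≤ ρ := norm_nonneg _
  have hρt : 1 ≤ ρ ^ 2 * t := by
    refine hij.trans ?_
    rw [sq]
    exact mul_le_mul_of_nonneg_right (mul_le_mul (hmax' i) (hmax' j) (norm_nonneg _) hρ0) ht0
  have hρpos : 0 < ρ ^ 2 := by nlinarith [sq_nonneg ρ]
  -- the values at `t' < ρ⁻²` are bounded by `M = (shintaniSelfSum w t).toReal`
  set M : ℝ := (shintaniSelfSum w t).toReal with hM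
  have hbound : ∀ t' : ℝ, 0 ≤ t' → ρ ^ 2 * t' < 1 →
      ‖w 0‖ ^ 2 * (((1 : ℝ) / 2) ^ (n * n) * (1 - ρ ^ 2 * t')⁻¹) ≤ M := by
    intro t' ht'0 ht'1
    have hsmall : ∀ a b, ‖x a‖ * ‖x b‖ * t' < 1 := fun a b => by
      refine lt_of_le_of_lt ?_ ht'1
      rw [sq]
      exact mul_le_mul_of_nonneg_right (mul_le_mul (hmax' a) (hmax' b) (norm_nonneg _) hρ0) ht'0
    have hsum := hasSum_shintaniSelf x w h0 hrec ht'0 hsmall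
    have ht't : t' ≤ t := by
      -- `ρ² t' < 1 ≤ ρ² t`
      by_contra! hlt
      have := mul_lt_mul_of_pos_left hlt hρpos
      linarith
    have hle : shintaniSelfSum w t' ≤ shintaniSelfSum w t := shintaniSelfSum_mono w ht'0 ht't
    have heq : shintaniSelfSum w t' =
        ENNReal.ofReal (‖w 0‖ ^ 2 * ‖∏ a, ∏ b, (1 - x a * conj (x b) * (t' : ℂ))⁻¹‖) := by
      rw [shintaniSelfSum, ← hsum.tsum_eq]
      exact (ENNReal.ofReal_tsum_of_nonneg
        (fun N => mul_nonneg (Finset.sum_nonneg fun m _ => sq_nonneg _) (pow_nonneg ht'0 N))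
        hsum.summable).symm
    rw [heq, ENNReal.ofReal_le_iff_le_toReal hfin] at hle
    refine le_trans ?_ hle
    exact mul_le_mul_of_nonneg_left (le_norm_prod_inv x hmax' ht'0 ht'1) (sq_nonneg _)
  -- choose `t'` with `1 - ρ² t' = δ` small
  set c : ℝ := ‖w 0‖ ^ 2 * ((1 : ℝ) / 2) ^ (n * n) with hc
  have hcpos : 0 < c := mul_pos (pow_pos (norm_pos_iff.mpr hw0) 2) (pow_pos (by norm_num) _)
  set δ : ℝ := min 1 (c / (|M| + c)) with hδ
  have hδpos : 0 < δ := lt_min one_pos (div_pos hcpos (by positivity))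
  have hδ1 : δ ≤ 1 := min_le_left _ _
  set t' : ℝ := (1 - δ) / ρ ^ 2 with ht'
  have ht'0 : 0 ≤ t' := div_nonneg (by linarith) hρpos.le
  have hρne : ρ ≠ 0 := fun h => by rw [h] at hρpos; simp at hρpos
  have hρt' : ρ ^ 2 * t' = 1 - δ := by rw [ht']; field_simp
  have key := hbound t' ht'0 (by rw [hρt']; linarith)
  rw [hρt', sub_sub_cancel, ← mul_assoc, ← hc] at key
  -- `c / δ ≤ M` contradicts `δ ≤ c / (|M| + c)`
  have hδle : δ ≤ c / (|M| + c) := min_le_right _ _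
  have h1 : c * δ⁻¹ ≥ |M| + c := by
    rw [ge_iff_le, ← div_eq_mul_inv, le_div_iff₀ hδpos]
    calc (|M| + c) * δ ≤ (|M| + c) * (c / (|M| + c)) :=
          mul_le_mul_of_nonneg_left hδle (by positivity)
      _ = c := by field_simp
  have h2 : M ≤ |M| := le_abs_self M
  linarith

/-! ### The Schur specialisation -/

/-- The Schur function of `x` truncated to antitone weights: `s_λ(x)` for antitone `λ ∈ ℕⁿ`
(partitions of length `≤ n`), `0` otherwise. [folklore] -/
def schurTrunc (x : Fin n → ℂ) (la : Fin n → ℕ) : ℂ := if Antitone la then schur x la else 0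

/-- `schurTrunc x 0 = 1`. [folklore] -/
@[simp]
theorem schurTrunc_zero (x : Fin n → ℂ) : schurTrunc x 0 = 1 := by
  have h : Antitone (0 : Fin n → ℕ) := fun _ _ _ => le_rfl
  simp [schurTrunc, h, schur_zero]

/-- `schurTrunc` vanishes off the antitone weights (definitional). [folklore] -/
theorem schurTrunc_of_not_antitone (x : Fin n → ℂ) {ν : Fin n → ℕ} (hν : ¬ Antitone ν) :
    schurTrunc x ν = 0 := if_neg hν

/-- `schurTrunc x` solves the dual Pieri recursions for `x`: `e_r(x) s_λ = ∑_{#S = r} s_{λ + 1_S}`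
for antitone `λ`, the non-antitone `λ + 1_S` contributing `0` (`esymm_mul_schur`,
`schur_addOn_eq_zero`; Macdonald 1995, Ch. I §5). [folklore] -/
theorem schurTrunc_pieri (x : Fin n → ℂ) (la : Fin n → ℕ) (hla : Antitone la) (r : ℕ)
    (_h1 : 1 ≤ r) (_hn : r ≤ n) :
    esymm x r * schurTrunc x la = ∑ S ∈ powersetCard r univ, schurTrunc x (addOn S la) := by
  rw [schurTrunc, if_pos hla, esymm_mul_schur]
  refine Finset.sum_congr rfl fun S _ => ?_
  by_cases hS : Antitone (addOn S la)
  · rw [schurTrunc, if_pos hS]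
  · rw [schurTrunc, if_neg hS, schur_addOn_eq_zero x hla hS]

/-- The **Schur self sum** `∑_N (∑_{λ antitone, |λ| = N} |s_λ(x)|²) t^N ∈ [0, ∞]` — the self
Shintani sum of `schurTrunc x`; for `|x_i| |x_j| t < 1` it equals `|∏_{i,j} (1 - x_i x̄_j t)⁻¹|`
(Cauchy's identity at `y = x̄`). [folklore] -/
def schurSelfSum (x : Fin n → ℂ) (t : ℝ) : ℝ≥0∞ := shintaniSelfSum (schurTrunc x) t

/-- A solution `w` of the dual Pieri recursions for `x` is `w(0) · schurTrunc x`
(`eq_schur_smul_of_pieri`). [folklore] -/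
theorem eq_mul_schurTrunc (x : Fin n → ℂ) (w : (Fin n → ℕ) → ℂ)
    (h0 : ∀ ν, ¬ Antitone ν → w ν = 0)
    (hrec : ∀ la, Antitone la → ∀ r, 1 ≤ r → r ≤ n →
      esymm x r * w la = ∑ S ∈ powersetCard r univ, w (addOn S la)) (m : Fin n → ℕ) :
    w m = w 0 * schurTrunc x m := by
  by_cases hm : Antitone m
  · rw [schurTrunc, if_pos hm, mul_comm]
    exact eq_schur_smul_of_pieri x w h0 (fun la hla r hr1 hrn => hrec la hla r hr1 hrn) hm
  · rw [h0 m hm, schurTrunc, if_neg hm, mul_zero]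

/-- `shintaniSelfSum w t = |w(0)|² · schurSelfSum x t` for a solution `w` of the dual Pieri
recursions for `x` (any real `t`). [folklore] -/
theorem shintaniSelfSum_eq_mul_schurSelfSum (x : Fin n → ℂ) (w : (Fin n → ℕ) → ℂ)
    (h0 : ∀ ν, ¬ Antitone ν → w ν = 0)
    (hrec : ∀ la, Antitone la → ∀ r, 1 ≤ r → r ≤ n →
      esymm x r * w la = ∑ S ∈ powersetCard r univ, w (addOn S la)) (t : ℝ) :
    shintaniSelfSum w t = ENNReal.ofReal (‖w 0‖ ^ 2) * schurSelfSum x t := by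
  rw [schurSelfSum, shintaniSelfSum, shintaniSelfSum, ← ENNReal.tsum_mul_left]
  refine tsum_congr fun N => ?_
  rw [← ENNReal.ofReal_mul (sq_nonneg _)]
  congr 1
  rw [← mul_assoc, Finset.mul_sum]
  congr 1
  refine Finset.sum_congr rfl fun m _ => ?_
  rw [eq_mul_schurTrunc x w h0 hrec m, norm_mul, mul_pow]

/-- The Schur case of `norm_mul_norm_mul_lt_one_of_shintaniSelfSum_ne_top`: if
`schurSelfSum x t < ∞` (`t ≥ 0`) then `|x_i| |x_j| t < 1` for all `i, j`. [folklore] -/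
theorem norm_mul_norm_mul_lt_one_of_schurSelfSum_ne_top (x : Fin n → ℂ) {t : ℝ} (ht0 : 0 ≤ t)
    (hfin : schurSelfSum x t ≠ ⊤) (i j : Fin n) : ‖x i‖ * ‖x j‖ * t < 1 :=
  norm_mul_norm_mul_lt_one_of_shintaniSelfSum_ne_top x (schurTrunc x)
    (fun _ hν => schurTrunc_of_not_antitone x hν) (schurTrunc_pieri x)
    (by rw [schurTrunc_zero]; exact one_ne_zero) ht0 hfin i j

/-- The Schur case of `shintaniSelfSum_eq_ofReal_exp`: for `|x_i| |x_j| t < 1` (`t ≥ 0`),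
`schurSelfSum x t = exp (∑_{k ≥ 1} |p_k(x)|² t^k / k)`, finite. [folklore] -/
theorem schurSelfSum_eq_ofReal_exp (x : Fin n → ℂ) {t : ℝ} (ht0 : 0 ≤ t)
    (ht : ∀ i j, ‖x i‖ * ‖x j‖ * t < 1) :
    schurSelfSum x t =
      ENNReal.ofReal (Real.exp (∑' k : ℕ, ‖∑ i, x i ^ (k + 1)‖ ^ 2 * t ^ (k + 1) / (k + 1))) := by
  rw [schurSelfSum, shintaniSelfSum_eq_ofReal_exp x (schurTrunc x)
    (fun _ hν => schurTrunc_of_not_antitone x hν) (schurTrunc_pieri x) ht0 ht, schurTrunc_zero,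
    norm_one, one_pow, one_mul]

/-- If `schurSelfSum x t < ∞` (`t ≥ 0`), then the series `∑_{k ≥ 1} |p_k(x)|² t^k / k` converges
and `schurSelfSum x t` is its exponential. [folklore] -/
theorem hasSum_of_schurSelfSum_ne_top (x : Fin n → ℂ) {t : ℝ} (ht0 : 0 ≤ t)
    (hfin : schurSelfSum x t ≠ ⊤) :
    ∃ G : ℝ, HasSum (fun k : ℕ => ‖∑ i, x i ^ (k + 1)‖ ^ 2 * t ^ (k + 1) / (k + 1)) G ∧
      schurSelfSum x t = ENNReal.ofReal (Real.exp G) := by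
  have ht := norm_mul_norm_mul_lt_one_of_schurSelfSum_ne_top x ht0 hfin
  obtain ⟨G, hG, -⟩ := hasSum_normSq_psum_and_prod_inv_eq_exp x ht0 ht
  exact ⟨G, hG, by rw [schurSelfSum_eq_ofReal_exp x ht0 ht, hG.tsum_eq]⟩

end Literature.RingTheory.SymmetricFunctions.SymmPoly
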